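import Literature.Topology.FourManifolds.ConnectedSum
import Literature.Topology.FourManifolds.ComplexProjectiveSpace
import Literature.Topology.FourManifolds.SmoothOrientation
import Literature.Topology.FourManifolds.HomotopyBallSlice
import Literature.Topology.FourManifolds.LeeRasmussen
import Literature.Topology.FourManifolds.SPC4Wave0

/-!
# Oriented `ℂℙ²`-towers `#ᵗ(ℂℙ², o)` and MMSW's adjunction inequality for `s` (Cor. 1.9), knot case

Vocabulary for the manifolds `#ᵗℂℙ²` / `#ᵗℂℙ²bar` of Manolescu–Marengon–Sarkar–Willis (2023), §6, in the tree's
relational language, and the knot case of their adjunction inequality for Rasmussen's invariant as a NAMED FACT.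

* `IsProjectiveTower o t P oP` — the closed smooth oriented 4-manifold `(P, oP)` is a `t`-fold ORIENTED connected sum of
  copies of `(ℂℙ², o)` (`t = 0`: `P ≅ S⁴`; `t + 1`: `(P, oP)` is an oriented connected sum, `IsOrientedConnectedSum`, of a
  tower of height `t` with `(ℂℙ², o)`).  For the complex orientation `o` these are the `#ᵗℂℙ²`, for `-o` the `#ᵗℂℙ²bar`;
  the definition never needs to know which of the two orientations of the tree's `ComplexProjectivePlane` is the complex
  one (its charts `affineChart` are oriented among themselves, `det_tangentCoordChange_pos`, but the sign relative to the
  complex structure depends on the real-coordinate convention `realCoordinates`).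
* `Knot.IsTowerSlice o K` — `K` bounds a smooth proper disc off a ball in some `o`-tower (`Knot.IsSliceDiscIn P e f`) whose
  ball chart `e` is ORIENTATION PRESERVING from the standard `ℝ⁴` (this is what distinguishes `K` from its mirror, cf.
  `Knot.IsSliceDiscIn.mirror`), ball and disc lying in an open `U ⊆ P` with `H₂(U; ℤ) = 0` — a sufficient, homology-light
  form of "the disc is null-homologous in `(P°, ∂P°)`", i.e. of `K` being H-slice in `(P, oP)` (MMSW Def. 6.2).
* `Knot.rasmussen_nonpos_of_isTowerSlice` (NAMED FACT, MMSW 2023 Cor. 1.9 with Def. 6.2 and Remark 6.6, knots): for ONE of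
  the two orientations `o` of `ℂℙ²` — the one whose `o`-towers are the printed `#ᵗℂℙ²bar` — every knot that is tower-slice
  over `o` has all its Rasmussen invariants `≤ 0`.  Stated with `∃ o` so that no chart/sign convention of the tree can make
  it false; the statement for the other orientation is the mirror image (Remark 6.6) and is derived by users from
  `Knot.IsSliceDiscIn.mirror` and `HasRasmussenInvariant.mirror`.

Deliberately NOT here: links, surfaces of higher genus, the general null-homologous hypothesis (only the `H₂(U) = 0`
neighbourhood form), uniqueness of oriented connected sums (an abstract `o`-tower IS `#ᵗ(ℂℙ², o)` up to
orientation-preserving diffeomorphism by `OrientedConnectedSumUniqueness.lean`, not needed to STATE the fact), and any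
proof: the printed proof needs Lee-homology cobordism maps and MMSW's `s` for links in `#ʳ(S¹ × S²)` (§§3–6), absent from
the tree.  At height `0` the fact contains one half of Rasmussen's slice theorem (`eq_zero_of_isSmoothlySlice`).
-/

noncomputable section

open scoped Manifold ContDiff Topology
open Set Function

namespace Literature.Topology.FourManifolds

/-- Local notation: the model space `ℝⁿ`. -/
local notation "𝔼 " n:arg => EuclideanSpace ℝ (Fin n)
/-- Local notation: the round 4-sphere. -/
local notation "𝕊⁴" => (Metric.sphere (0 : EuclideanSpace ℝ (Fin 5)) 1)

/-- **Oriented `ℂℙ²`-tower of height `t` over the orientation `o` of `ℂℙ²`.**  `IsProjectiveTower o t P oP`: the closed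
smooth oriented 4-manifold `(P, oP)` is a `t`-fold oriented connected sum of copies of `(ℂℙ², o)` — height `0` means
`P` is diffeomorphic to `S⁴` (with either orientation: `S⁴` admits orientation-reversing diffeomorphisms), height `t + 1`
means `(P, oP)` is an oriented connected sum `(Q, oQ) # (ℂℙ², o)` (`IsOrientedConnectedSum oQ o oP`) of a tower `(Q, oQ)`
of height `t` with `(ℂℙ², o)`.  For `o` the complex orientation these are the printed `#ᵗℂℙ²`, for `-o` the `#ᵗℂℙ²bar`.
A definition (predicate), not a named fact. [cite: ManolescuMarengonSarkarWillis2023, §6 (the manifolds #ᵗℂℙ²bar) and Def. 6.2] -/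
def IsProjectiveTower (o : SmoothOrientation (𝓡 4) ComplexProjectivePlane) :
    ℕ → ∀ (P : Type) [TopologicalSpace P] [T2Space P] [SecondCountableTopology P]
      [ChartedSpace (𝔼 4) P] [IsManifold (𝓡 4) ∞ P] [CompactSpace P], SmoothOrientation (𝓡 4) P → Prop
  | 0 => fun P _ _ _ _ _ _ _ => Nonempty (P ≃ₘ⟮𝓡 4, 𝓡 4⟯ 𝕊⁴)
  | t + 1 => fun _ _ _ _ _ _ _ oP =>
      ∃ (Q : Type) (_ : TopologicalSpace Q) (_ : T2Space Q) (_ : SecondCountableTopology Q)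
        (_ : ChartedSpace (𝔼 4) Q) (_ : IsManifold (𝓡 4) ∞ Q) (_ : CompactSpace Q)
        (oQ : SmoothOrientation (𝓡 4) Q),
        IsProjectiveTower o t Q oQ ∧ IsOrientedConnectedSum oQ o oP

/-- Height `0`: a tower of height `0` is a manifold diffeomorphic to `S⁴`, whatever `o` and `oP` (unfolding lemma).
[cite: ManolescuMarengonSarkarWillis2023, §6] -/
theorem isProjectiveTower_zero_iff (o : SmoothOrientation (𝓡 4) ComplexProjectivePlane) (P : Type)
    [TopologicalSpace P] [T2Space P] [SecondCountableTopology P] [ChartedSpace (𝔼 4) P] [IsManifold (𝓡 4) ∞ P]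
    [CompactSpace P] (oP : SmoothOrientation (𝓡 4) P) :
    IsProjectiveTower o 0 P oP ↔ Nonempty (P ≃ₘ⟮𝓡 4, 𝓡 4⟯ 𝕊⁴) := Iff.rfl

/-- The round `S⁴` with any orientation is a tower of height `0` over either orientation of `ℂℙ²`.
[cite: ManolescuMarengonSarkarWillis2023, §6] -/
theorem isProjectiveTower_zero_sphere (o : SmoothOrientation (𝓡 4) ComplexProjectivePlane)
    (oS : SmoothOrientation (𝓡 4) 𝕊⁴) : IsProjectiveTower o 0 𝕊⁴ oS :=
  ⟨Diffeomorph.refl _ _ _⟩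

/-- **Reversing the orientation of `ℂℙ²` and of the tower**: an `o`-tower `(P, oP)` is a `(-o)`-tower `(P, -oP)` of the
same height — `(-Q) # (-ℂℙ²) = -(Q # ℂℙ²)` (`IsOrientedConnectedSum.neg`) and height `0` is orientation-free.  This is the
tree form of "`#ᵗℂℙ²bar` is `#ᵗℂℙ²` with the opposite orientation". [cite: KervaireMilnor1963, §2] -/
theorem IsProjectiveTower.neg (o : SmoothOrientation (𝓡 4) ComplexProjectivePlane) :
    ∀ (t : ℕ) (P : Type) [TopologicalSpace P] [T2Space P] [SecondCountableTopology P]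
      [ChartedSpace (𝔼 4) P] [IsManifold (𝓡 4) ∞ P] [CompactSpace P] (oP : SmoothOrientation (𝓡 4) P),
      IsProjectiveTower o t P oP → IsProjectiveTower (-o) t P (-oP) := by
  intro t
  induction t with
  | zero => intro P _ _ _ _ _ _ oP h; exact h
  | succ t ih =>
    intro P _ _ _ _ _ _ oP h
    obtain ⟨Q, _, _, _, _, _, _, oQ, hQ, hcs⟩ := h
    exact ⟨Q, _, ‹_›, ‹_›, _, ‹_›, ‹_›, -oQ, ih Q oQ hQ, hcs.neg⟩

/-- **Tower-slice over `o`** (the tree-level, homology-light form of "H-slice in `#ᵗ(ℂℙ², o)`", MMSW Def. 6.2 /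
Manolescu–Piccirillo Def. 2.1).  `K.IsTowerSlice o`: for some `o`-tower `(P, oP)` there are slice data
`K.IsSliceDiscIn P e f` (a smooth ball `e : ℝ⁴ ↪ P` and a smooth proper disc `f|_{𝔻²}` in `P ∖ e(B̊⁴)` bounded by `e ∘ K`)
whose ball chart `e` is ORIENTATION PRESERVING from the standard `ℝ⁴` (`SmoothOrientation.euclidean 4`) to `(P, oP)`, and an
open `U ⊆ P` containing `e(ℝ⁴)` and `f(ℝ²)` with `H₂(U; ℤ) = 0`, so that the disc is null-homologous in `(P°, ∂P°)`
(`H₂(U ∖ e(B̊⁴), e(S³)) ≅ H₂(U ∖ pt) ≅ H₂(U) = 0` maps to `H₂(P°, ∂P°)`).  A definition (predicate in `o`, `K`).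
[cite: ManolescuMarengonSarkarWillis2023, Def. 6.2] [cite: ManolescuPiccirillo2023, Def. 2.1 and Def. 2.4] -/
def Knot.IsTowerSlice (o : SmoothOrientation (𝓡 4) ComplexProjectivePlane) (K : Knot) : Prop :=
  ∃ (t : ℕ) (P : Type) (_ : TopologicalSpace P) (_ : T2Space P) (_ : SecondCountableTopology P)
    (_ : ChartedSpace (𝔼 4) P) (_ : IsManifold (𝓡 4) ∞ P) (_ : CompactSpace P)
    (oP : SmoothOrientation (𝓡 4) P) (e : 𝔼 4 → P) (f : 𝔼 2 → P),
    IsProjectiveTower o t P oP ∧ K.IsSliceDiscIn P e f ∧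
      IsOrientationPreserving (SmoothOrientation.euclidean 4) oP e ∧
      ∃ U : TopologicalSpace.Opens P, (∀ v, e v ∈ U) ∧ (∀ y, f y ∈ U) ∧
        CategoryTheory.Limits.IsZero (singularHomologyZ (↥U) 2)

/-- **MMSW 2023, Cor. 1.9 (adjunction inequality for `s`), knot case, in tower-slice form — NAMED FACT.**  As printed
(Cor. 1.9 = Cor. 6.12): "Let `W = (#ᵗℂℙ²bar) ∖ B⁴` for some `t ≥ 0`. Let `L ⊂ ∂W = S³` be a link, and `Σ ⊂ W` a
properly, smoothly embedded oriented surface with no closed components, such that `∂Σ = L` and `[Σ] = 0 ∈ H₂(W, ∂W)`.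
Then `s(L) ≤ 1 − χ(Σ)`"; for a knot and a disc: `K` H-slice in `#ᵗℂℙ²bar` ⇒ `s(K) ≤ 0` (Cor. 6.13 with `|L| = 1`; e.g.
`T(2,−3)`, `s = −2`, is strongly H-slice in `ℂℙ²bar`, Ex. 6.4), and by Remark 6.6 (`L` strongly H-slice in `ℂℙ²bar` iff
`L̄` strongly slice in `ℂℙ²`) the mirror statement `s ≥ 0` for `#ᵗℂℙ²`.  Rendered here as: THERE IS an orientation `o` of
the tree's `ℂℙ²` (namely the one whose `o`-towers, read with orientation-preserving ball charts, are the printed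
`#ᵗℂℙ²bar`) such that every knot tower-slice over `o` has all its Rasmussen invariants `≤ 0` — the `∃ o` makes the
statement independent of which orientation of `ComplexProjectivePlane` is the complex one and of the boundary-orientation
convention hidden in `Knot.IsSliceDiscIn` (exactly one of the two orientations satisfies it, the other satisfies the
mirrored inequality).  Inputs of the printed proof not in the tree: Lee-homology cobordism maps (Rasmussen 2010 §4,
Beliakova–Wehrli), MMSW's `s` for null-homologous links in `#ʳ(S¹ × S²)` and `s(F_p(1)) = 1 − 2p` (Thm. 1.7).  At height
`0` (`P ≅ S⁴`) this is one half of Rasmussen's slice theorem `eq_zero_of_isSmoothlySlice`.  Users take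
`(h : Knot.rasmussen_nonpos_of_isTowerSlice)`.  TODO(general form): links `L`, surfaces `Σ` with `χ(Σ)`, and the
hypothesis `[Σ] = 0 ∈ H₂(W, ∂W)` instead of an `H₂ = 0` neighbourhood; both need relative `H₂` of manifolds with
boundary, which the tree does not have.
[cite: ManolescuMarengonSarkarWillis2023, Cor. 1.9, Def. 6.2, Cor. 6.13 and Remark 6.6] -/
def Knot.rasmussen_nonpos_of_isTowerSlice : Prop :=
  ∃ o : SmoothOrientation (𝓡 4) ComplexProjectivePlane, ∀ (K : Knot), K.IsTowerSlice o →
    ∀ s : ℤ, K.HasRasmussenInvariant s → s ≤ 0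

end Literature.Topology.FourManifolds

end
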